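import Summits.CriticalPhenomena.PercolationContinuityZ3.Theorems.PercNearOneGluingNoHeavyLowerTailUpsetExchangeUnion
import Summits.CriticalPhenomena.PercolationContinuityZ3.Theorems.PercNearOneGluingNoHeavyLowerTailBlockQ9OneDangerousPort
import HarnessLib

/-!
# `NoHeavyLowerTail` (stmt-CriticalPhenomena-4575) — Theorem 4 for a glued block LOCALISED to `{O ↔ a}`, and the
# block form of the three-relay exchange (the exchange step of the weakest-port peeling theorem)

Support file (lemma factory `prim-lf-3` gen 6, seat g7; `--supports stmt-CriticalPhenomena-4575`).  No definitions, no
named facts, no sorries.  Memo: `run/shared/lean/prim/prim-lf-3/LF3-Q9LP.md` §7–8.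

Setting (`Fin n`): block `O` (one-layer: `hiso`), relays `A` disjoint from `O`, `μ_g` = `glue_O w`, `kill_O w` = pairs meeting
`O` zeroed.  `BlockQ9.blockThm4_witness` (prim-hp-1) is Kozma–Nitzan's Theorem 4 for the block: a vertex `v` dominated in
`kill_O w` by every port satisfies `μ_g(v ↔ b, O ↔ A) ≤ μ_g(O ↔ b)`.  Here:

* `blockThm4_witness_inter` — the same comparison INTERSECTED with the increasing block-cluster event `{O ↔ a}`
  (`a ∉ O` any vertex): `μ_g(v ↔ b, O ↔ a) ≤ μ_g(O ↔ b, O ↔ a)`.  Proof = the layer (σ-law) decomposition of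
  `blockThm4_witness` with, on each layer, `UpsetExchange.upsetExchange_event` for the event `{S ↔ a}` (increasing in the
  open edge cluster of a port `p ∈ S`) in place of the gluing Lemma 5.
* `blockThreeRelayExchange` — THREE-RELAY EXCHANGE, block form: under the same hypotheses,
  `μ_g(v ↔ b, O ↮ b, O ↔ a) ≤ μ_g(O ↔ b, v ↮ b, a ↮ v)`  ("weak relay reaches `b`, block does not, spectator in the block's
  cluster" ≤ "block reaches `b`, weak relay does not, spectator off the weak relay's cluster").  This is the exchange step of
  the WEAKEST-PORT PEELING theorem (memo §8, paper proof; 0 / 1 100 exact checks):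
  `T_a(O) ≥ P_w·[μ_g(w ↔ b) − μ_g(a ↔ b)] + (1 − P_w)·T_a(O ∖ w)` for the `kill_O`-weakest port `w`, where
  `T_a(O) := μ_g(O ↔ b) − μ_g(a ↔ b, O ↔ A)`.
-/

namespace Summit.CriticalPhenomena.PercolationContinuityZ3.Theorems

open MeasureTheory Set ProbabilityTheory
open Literature.Probability.LatticeModels
open Literature.Probability.Percolation

noncomputable section
open Classical

namespace BlockQ9

variable {n : ℕ}

/-- **Theorem 4 for a glued one-layer block, localised to `{O ↔ a}`.**  `O` one-layer w.r.t. `A` (`hiso`); `v, b, a ∉ O`;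
`v` dominated in `kill_O w` by every port of `O`.  Then `μ_{glue_O w}(v ↔ b, O ↔ a) ≤ μ_{glue_O w}(O ↔ b, O ↔ a)`.
[cite: KozmaNitzan2024, Thm. 4, Lemma 5, Lemma 3(i) (pp. 6, 12–14); VandenbergHaggstromKahn2005, Thm. 1.2] -/
theorem blockThm4_witness_inter (w : Sym2 (Fin n) → unitInterval) (O A : Finset (Fin n)) (v b a : Fin n)
    (hvO : v ∉ O) (hbO : b ∉ O) (haO : a ∉ O)
    (hiso : ∀ x ∈ O, ∀ y : Fin n, y ∉ O → y ∉ A → w s(x, y) = 0)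
    (hdom : ∀ p ∈ A, (∃ o ∈ O, w s(o, p) ≠ 0) →
      (prodBernoulli (fun e : Sym2 (Fin n) => if (∃ x ∈ e, x ∈ O) then 0 else w e)).real (openConn v b) ≤
        (prodBernoulli (fun e : Sym2 (Fin n) => if (∃ x ∈ e, x ∈ O) then 0 else w e)).real (openConn p b)) :
    (prodBernoulli (fun e : Sym2 (Fin n) => if (∀ x ∈ e, x ∈ O) ∧ ¬ e.IsDiag then 1 else w e)).real
        (openConn v b ∩ ⋃ o ∈ O, openConn o a) ≤
      (prodBernoulli (fun e : Sym2 (Fin n) => if (∀ x ∈ e, x ∈ O) ∧ ¬ e.IsDiag then 1 else w e)).real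
        ((⋃ o ∈ O, openConn o b) ∩ ⋃ o ∈ O, openConn o a) := by
  classical
  set g : Sym2 (Fin n) → unitInterval := fun e => if (∀ x ∈ e, x ∈ O) ∧ ¬ e.IsDiag then 1 else w e with hg
  set k : Sym2 (Fin n) → unitInterval := fun e => if (∃ x ∈ e, x ∈ O) then 0 else w e with hk
  -- layer decomposition of both sides
  rw [sigmaRec_partition g O (openConn v b ∩ _), sigmaRec_partition g O ((⋃ o ∈ O, openConn o b) ∩ _)]
  refine Finset.sum_le_sum fun S _ => ?_
  set L : Set (BondConfig (Fin n)) := {ω | ∀ x : Fin n, x ∈ S ↔ (x ∉ O ∧ ∃ o ∈ O, s(o, x) ∈ ω)} with hL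
  set Ψ : BondConfig (Fin n) → BondConfig (Fin n) := fun ω =>
    ({e | e ∈ ω ∧ ∀ x ∈ e, x ∉ O} ∪ {e | (∀ x ∈ e, x ∈ S) ∧ ¬ e.IsDiag} : BondConfig (Fin n)) with hΨ
  set gS : Sym2 (Fin n) → unitInterval := fun e =>
    if (∀ x ∈ e, x ∈ S) ∧ ¬ e.IsDiag then 1 else if (∃ x ∈ e, x ∈ O) then 0 else w e with hgS
  -- internal pairs of `O` are a.s. open under the glued weights
  set K : Set (BondConfig (Fin n)) := {ω | ∀ o ∈ O, ∀ o' ∈ O, o ≠ o' → s(o, o') ∈ ω} with hK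
  have hKc : prodBernoulli g Kᶜ = 0 := by
    refine sigmaRec_conull g K fun ω hω => ?_
    simp only [hK, mem_setOf_eq, not_forall] at hω
    obtain ⟨o, ho, o', ho', hne, hclosed⟩ := hω
    refine ⟨s(o, o'), ?_, hclosed⟩
    simp only [hg]
    rw [if_pos ⟨fun x hx => by rcases Sym2.mem_iff.1 hx with rfl | rfl <;> assumption,
      by rw [Sym2.mk_isDiag_iff]; exact hne⟩]
  -- geometry on `L ∩ K`
  have hOa : Disjoint O {a} := Finset.disjoint_singleton_right.2 haO
  have hOb : Disjoint O {b} := Finset.disjoint_singleton_right.2 hbO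
  have hgeomA : ∀ ω, ω ∈ L → ω ∈ K →
      (ω ∈ (openConn v b ∩ ⋃ o ∈ O, openConn o a : Set (BondConfig (Fin n))) ↔
        ω ∈ Ψ ⁻¹' (openConn v b ∩ ⋃ s ∈ S, openConn s a)) := by
    intro ω hωL hωK
    obtain ⟨h1, h2⟩ := stub_sigmaGeometry n O S ω hωL hωK
    have ha := h1 {a} hOa
    simp only [Finset.mem_singleton, iUnion_iUnion_eq_left] at ha
    simp only [mem_preimage, mem_inter_iff]
    exact and_congr (h2 v b hvO hbO) ha
  have hgeomB : ∀ ω, ω ∈ L → ω ∈ K →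
      (ω ∈ ((⋃ o ∈ O, openConn o b) ∩ ⋃ o ∈ O, openConn o a : Set (BondConfig (Fin n))) ↔
        ω ∈ Ψ ⁻¹' ((⋃ s ∈ S, openConn s b) ∩ ⋃ s ∈ S, openConn s a)) := by
    intro ω hωL hωK
    obtain ⟨h1, -⟩ := stub_sigmaGeometry n O S ω hωL hωK
    have ha := h1 {a} hOa
    have hb := h1 {b} hOb
    simp only [Finset.mem_singleton, iUnion_iUnion_eq_left] at ha hb
    simp only [mem_preimage, mem_inter_iff]
    exact and_congr hb ha
  -- null layers
  by_cases hgen : ∀ x ∈ S, x ∉ O ∧ ∃ o ∈ O, w s(o, x) ≠ 0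
  swap
  · have hL0 : (prodBernoulli g).real L = 0 := by
      push Not at hgen
      obtain ⟨x, hxS, hx⟩ := hgen
      by_cases hxO : x ∈ O
      · have hLe : L = ∅ := by
          ext ω
          simp only [hL, mem_setOf_eq, mem_empty_iff_false, iff_false]
          intro h
          exact ((h x).1 hxS).1 hxO
        rw [hLe, measureReal_empty]
      · refine sigmaRec_null g L (O.image fun o => s(o, x)) (fun e he => ?_) (fun ω hω => ?_)
        · obtain ⟨o, ho, rfl⟩ := Finset.mem_image.1 he
          have hw0 : w s(o, x) = 0 := hx hxO o ho
          have hnot : ¬ ((∀ y ∈ s(o, x), y ∈ O) ∧ ¬ (s(o, x)).IsDiag) := fun h =>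
            hxO (h.1 x (Sym2.mem_mk_right o x))
          simp only [hg]
          rw [if_neg hnot, hw0]
        · obtain ⟨-, o, ho, hox⟩ := ((hω : ω ∈ L) x |>.1) hxS
          exact ⟨s(o, x), Finset.mem_image.2 ⟨o, ho, rfl⟩, hox⟩
    calc (prodBernoulli g).real (L ∩ (openConn v b ∩ ⋃ o ∈ O, openConn o a))
        ≤ (prodBernoulli g).real L := measureReal_mono inter_subset_left
      _ = 0 := hL0
      _ ≤ _ := measureReal_nonneg
  rw [sigmaRec_inter_congr g hKc hgeomA, sigmaRec_inter_congr g hKc hgeomB]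
  -- the empty layer: the block is isolated, the left event is empty
  rcases S.eq_empty_or_nonempty with hSe | hSne
  · have h0 : Ψ ⁻¹' (openConn v b ∩ ⋃ s ∈ S, (openConn s a : Set (BondConfig (Fin n)))) = ∅ := by
      rw [hSe]; ext ω; simp
    rw [h0, inter_empty, measureReal_empty]
    exact measureReal_nonneg
  -- the layer law
  have hlawA := stub_sigmaLaw n w O S (openConn v b ∩ ⋃ s ∈ S, openConn s a)
  have hlawB := stub_sigmaLaw n w O S ((⋃ s ∈ S, openConn s b) ∩ ⋃ s ∈ S, openConn s a)
  change (prodBernoulli g).real (L ∩ Ψ ⁻¹' _) = (prodBernoulli g).real L * (prodBernoulli gS).real _ at hlawA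
  change (prodBernoulli g).real (L ∩ Ψ ⁻¹' _) = (prodBernoulli g).real L * (prodBernoulli gS).real _ at hlawB
  rw [hlawA, hlawB]
  refine mul_le_mul_of_nonneg_left ?_ measureReal_nonneg
  -- the layer inequality in the world `glue_S (kill_O w)`: up-set exchange for the event `{S ↔ a}`, anchored at a port
  obtain ⟨p, hpS⟩ := hSne
  obtain ⟨hpO, hport⟩ := hgen p hpS
  have hpA : p ∈ A := by
    by_contra hpA
    obtain ⟨o, ho, hw⟩ := hport
    exact hw (hiso o ho p hpO hpA)
  set E : Set (BondConfig (Fin n)) := ⋃ s ∈ S, openConn s a with hEdef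
  have hE : ∀ ω ω' : BondConfig (Fin n), ω ∈ E →
      (∀ e : Sym2 (Fin n), (∀ x ∈ e, x ∈ S) → ¬ e.IsDiag → e ∈ ω) →
      openEdgeCluster ω p ⊆ openEdgeCluster ω' p →
      ω' ∈ E ∧ ∀ e : Sym2 (Fin n), (∀ x ∈ e, x ∈ S) → ¬ e.IsDiag → e ∈ ω' := by
    intro ω ω' hω hF hsub
    have key := UpsetExchange.mem_openEdgeCluster_of_open_mem S p hpS ω hF
    refine ⟨?_, fun e heS hed => ?_⟩
    · rw [hEdef] at hω ⊢
      obtain ⟨s, hs, hsa⟩ : ∃ s ∈ S, ω ∈ (openConn s a : Set (BondConfig (Fin n))) := by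
        simpa only [Set.mem_iUnion, exists_prop] using hω
      have hpa : (openGraph ω).Reachable p a := (key.1 s hs).trans hsa
      have hpa' : (openGraph ω').Reachable p a := by
        rw [reachable_iff_exists_mem_openEdgeCluster] at hpa ⊢
        rcases hpa with h | ⟨e, he, hae⟩
        · exact Or.inl h
        · exact Or.inr ⟨e, hsub he, hae⟩
      have : ω' ∈ (openConn p a : Set (BondConfig (Fin n))) := hpa'
      simpa only [Set.mem_iUnion, exists_prop] using ⟨p, hpS, this⟩
    · have heω : e ∈ ω := hF e heS hed
      have hSne' : ∃ x ∈ e, x ∈ S := by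
        induction e using Sym2.ind with
        | h x y => exact ⟨x, Sym2.mem_mk_left x y, heS x (Sym2.mem_mk_left x y)⟩
      exact openEdgeCluster_subset ω' p (hsub (key.2 e heω hed hSne'))
  have hx := UpsetExchange.upsetExchange_event k S v b p E hE (hdom p hpA hport)
  -- `glue_S (kill_O w)` is the layer law `gS`
  have hgSk : (fun e : Sym2 (Fin n) => if (∀ x ∈ e, x ∈ S) ∧ ¬ e.IsDiag then 1 else k e) = gS := by
    funext e; simp only [hgS, hk]
  rw [hgSk] at hx
  refine hx.trans (measureReal_mono ?_ (measure_ne_top _ _))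
  rintro ω ⟨hpb, hωE⟩
  exact ⟨mem_iUnion₂.2 ⟨p, hpS, hpb⟩, hωE⟩

/-- **Three-relay exchange, block form.**  Under the hypotheses of `blockThm4_witness_inter`:
`μ_g(v ↔ b, O ↮ b, O ↔ a) ≤ μ_g(O ↔ b, v ↮ b, a ↮ v)`.  Proof: remove the common part `{v ↔ b} ∩ {O ↔ b} ∩ {O ↔ a}` from the
two sides of `blockThm4_witness_inter` and use `{O ↔ b, O ↔ a, v ↮ b} ⊆ {O ↔ b, v ↮ b, a ↮ v}`.
[cite: KozmaNitzan2024, Thm. 4, Lemma 3(i) (pp. 6, 12–14); VandenbergHaggstromKahn2005, Thm. 1.2] -/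
theorem blockThreeRelayExchange (w : Sym2 (Fin n) → unitInterval) (O A : Finset (Fin n)) (v b a : Fin n)
    (hvO : v ∉ O) (hbO : b ∉ O) (haO : a ∉ O)
    (hiso : ∀ x ∈ O, ∀ y : Fin n, y ∉ O → y ∉ A → w s(x, y) = 0)
    (hdom : ∀ p ∈ A, (∃ o ∈ O, w s(o, p) ≠ 0) →
      (prodBernoulli (fun e : Sym2 (Fin n) => if (∃ x ∈ e, x ∈ O) then 0 else w e)).real (openConn v b) ≤
        (prodBernoulli (fun e : Sym2 (Fin n) => if (∃ x ∈ e, x ∈ O) then 0 else w e)).real (openConn p b)) :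
    (prodBernoulli (fun e : Sym2 (Fin n) => if (∀ x ∈ e, x ∈ O) ∧ ¬ e.IsDiag then 1 else w e)).real
        (openConn v b ∩ (⋃ o ∈ O, openConn o b)ᶜ ∩ ⋃ o ∈ O, openConn o a) ≤
      (prodBernoulli (fun e : Sym2 (Fin n) => if (∀ x ∈ e, x ∈ O) ∧ ¬ e.IsDiag then 1 else w e)).real
        ((⋃ o ∈ O, openConn o b) ∩ (openConn v b)ᶜ ∩ (openConn a v)ᶜ) := by
  set g : Sym2 (Fin n) → unitInterval := fun e => if (∀ x ∈ e, x ∈ O) ∧ ¬ e.IsDiag then 1 else w e with hg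
  set E : Set (BondConfig (Fin n)) := ⋃ o ∈ O, openConn o a with hEdef
  set OB : Set (BondConfig (Fin n)) := ⋃ o ∈ O, openConn o b with hOB
  have hx := blockThm4_witness_inter w O A v b a hvO hbO haO hiso hdom
  set Z : Set (BondConfig (Fin n)) := openConn v b ∩ OB ∩ E with hZ
  have hL : (prodBernoulli g).real (openConn v b ∩ OBᶜ ∩ E) =
      (prodBernoulli g).real (openConn v b ∩ E) - (prodBernoulli g).real Z := by
    have hsplit := measureReal_inter_add_sdiff (μ := prodBernoulli g) (s := openConn v b ∩ E)
      (MeasurableSet.of_discrete : MeasurableSet OB) (measure_ne_top _ _)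
    have h1 : openConn v b ∩ E ∩ OB = Z := by
      rw [hZ]; ext ω; simp only [mem_inter_iff]; tauto
    have h2 : (openConn v b ∩ E) \ OB = openConn v b ∩ OBᶜ ∩ E := by
      ext ω; simp only [mem_sdiff, mem_inter_iff, mem_compl_iff]; tauto
    rw [h1, h2] at hsplit
    linarith
  -- internal pairs of `O` are a.s. open under the glued weights (needed for the pointwise step below)
  set K : Set (BondConfig (Fin n)) := {ω | ∀ o ∈ O, ∀ o' ∈ O, o ≠ o' → s(o, o') ∈ ω} with hK
  have hKc : prodBernoulli g Kᶜ = 0 := by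
    refine sigmaRec_conull g K fun ω hω => ?_
    simp only [hK, mem_setOf_eq, not_forall] at hω
    obtain ⟨o, ho, o', ho', hne, hclosed⟩ := hω
    refine ⟨s(o, o'), ?_, hclosed⟩
    simp only [hg]
    rw [if_pos ⟨fun x hx => by rcases Sym2.mem_iff.1 hx with rfl | rfl <;> assumption,
      by rw [Sym2.mk_isDiag_iff]; exact hne⟩]
  have hR : (prodBernoulli g).real (OB ∩ E) - (prodBernoulli g).real Z ≤
      (prodBernoulli g).real (OB ∩ (openConn v b)ᶜ ∩ (openConn a v)ᶜ) := by
    have hsplit := measureReal_inter_add_sdiff (μ := prodBernoulli g) (s := OB ∩ E)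
      (MeasurableSet.of_discrete : MeasurableSet (openConn v b : Set (BondConfig (Fin n)))) (measure_ne_top _ _)
    have h1 : OB ∩ E ∩ openConn v b = Z := by
      rw [hZ]; ext ω; simp only [mem_inter_iff]; tauto
    set Y : Set (BondConfig (Fin n)) := (OB ∩ E) \ openConn v b with hY
    have hYK0 : (prodBernoulli g).real (Y \ K) = 0 := by
      have h0 : prodBernoulli g (Y \ K) = 0 := measure_mono_null (fun ω hω => hω.2) hKc
      simp only [measureReal_def, h0, ENNReal.toReal_zero]
    have hYsplit := measureReal_inter_add_sdiff (μ := prodBernoulli g) (s := Y)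
      (MeasurableSet.of_discrete : MeasurableSet K) (measure_ne_top _ _)
    have h2 : (prodBernoulli g).real (Y ∩ K) ≤
        (prodBernoulli g).real (OB ∩ (openConn v b)ᶜ ∩ (openConn a v)ᶜ) := by
      refine measureReal_mono ?_ (measure_ne_top _ _)
      rintro ω ⟨⟨⟨hOb, hOa⟩, hvb⟩, hωK⟩
      refine ⟨⟨hOb, hvb⟩, fun hav => hvb ?_⟩
      rw [hOB] at hOb
      rw [hEdef] at hOa
      obtain ⟨o', ho', ho'b⟩ : ∃ o' ∈ O, ω ∈ (openConn o' b : Set (BondConfig (Fin n))) := by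
        simpa only [Set.mem_iUnion, exists_prop] using hOb
      obtain ⟨o, ho, hoa⟩ : ∃ o ∈ O, ω ∈ (openConn o a : Set (BondConfig (Fin n))) := by
        simpa only [Set.mem_iUnion, exists_prop] using hOa
      have hoo' : (openGraph ω).Reachable o o' := by
        by_cases h : o = o'
        · rw [h]
        · exact ((openGraph_adj ω o o').2 ⟨hωK o ho o' ho' h, h⟩).reachable
      have hva : (openGraph ω).Reachable a v := hav
      have hoa' : (openGraph ω).Reachable o a := hoa
      have ho'b' : (openGraph ω).Reachable o' b := ho'b
      exact ((hva.symm.trans hoa'.symm).trans hoo').trans ho'b'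
    rw [h1] at hsplit
    linarith
  calc (prodBernoulli g).real (openConn v b ∩ OBᶜ ∩ E)
      = (prodBernoulli g).real (openConn v b ∩ E) - (prodBernoulli g).real Z := hL
    _ ≤ (prodBernoulli g).real (OB ∩ E) - (prodBernoulli g).real Z := by linarith
    _ ≤ (prodBernoulli g).real (OB ∩ (openConn v b)ᶜ ∩ (openConn a v)ᶜ) := hR

end BlockQ9

end

end Summit.CriticalPhenomena.PercolationContinuityZ3.Theorems
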